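import Summits.HubbardSuperconductivity.HubbardSuperconductivity.Theorems.WeakCouplingBCSWcbcsSsbToTorusLROInfraredHalf
import Summits.HubbardSuperconductivity.HubbardSuperconductivity.Theorems.WeakCouplingBCSWcbcsSsbToTorusLROFacePurityHalf
import Summits.HubbardSuperconductivity.HubbardSuperconductivity.Theorems.ChiralWindowCwSsbToEvenTorusLROCanonicalSupportingPotential
import HarnessLib

/-!
# Crux `WcbcsSsbToTorusLRO` (stmt-HubbardSuperconductivity-2009), line `off-zero-mode-moment-closure` ⊕ `neutral-curvature-face-purity`:
# the crux CLOSED MODULO torus pair stiffness (T), the neutral-curvature floor (N) and the charging floor (C) — nothing else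

`wcbcsSsbToTorusLRO_of_stiffness_curvature_charging` — the crux BY NAME from the three OPEN physical inputs of the line in their
registered guarded forms — (T) `stub_torusPairStiffness`, (N) `stub_neutralCurvature`, (C) `stub_chargingFloor` (stubs of
stmt-HubbardSuperconductivity-2009) — and NOTHING ELSE: the canonical/grand-canonical step (item stmt-HubbardSuperconductivity-9491
`AbsenceCertificate.CanonicalSupportingPotential`) is DISCHARGED by the landed
`CwSsbToEvenTorusLRO.stub_canonicalSupportingPotential` (T = 0 equivalence of ensembles, every real `U`). The window is the smallest of the three; at each guarded `(U, δ, μ)` the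
face-purity half (`derivFacePurity_of_neutralCurvature`, landed companion) and the infrared half
(`infraredLeak_of_stiffness_of_charging`, landed companion) feed the landed `Negative.FacePurityDissection.floor_of_deriv_of_leak`,
and the floor is the summit matrix at `(U, δ)` (`Negative.SummitMatrixUniformFloor.hasDWavePairFieldLROAt_of_floor`), i.e. the
crux body definitionally. This is the line's registered skeleton with its three physical stubs turned into hypotheses.
-/

noncomputable section

set_option linter.dupNamespace false

namespace Summit.HubbardSuperconductivity.HubbardSuperconductivity.Theorems.WcbcsSsbToTorusLRO

open Literature.MathematicalPhysics.QuantumLattice Literature.Probability.LatticeModels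
open Summit.HubbardSuperconductivity.WcbcsSsbToTorusLRO.Negative (floor_of_deriv_of_leak hasDWavePairFieldLROAt_of_floor)
open Matrix Filter Set
open scoped ComplexOrder ComplexConjugate
open Summit.HubbardSuperconductivity.HubbardSuperconductivity.Theses.WeakCouplingBCS (WcbcsSsbToTorusLRO)

/-! ### The crux, closed modulo (T), (N), (C) -/

/-- **`WcbcsSsbToTorusLRO` from torus pair stiffness (T), the neutral-curvature floor (N), the charging floor (C) — the
three OPEN physical inputs of the line in their registered guarded forms; the canonical/GC equivalence (item 9491) is
DISCHARGED by the landed `CwSsbToEvenTorusLRO.stub_canonicalSupportingPotential`.** The window is the smallest of the three; at each guarded `(U, δ, μ)`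
the face-purity half and the infrared half feed the landed `floor_of_deriv_of_leak`, and the floor is the summit matrix
at `(U, δ)` (`hasDWavePairFieldLROAt_of_floor`), which is the crux body definitionally. -/
theorem wcbcsSsbToTorusLRO_of_stiffness_curvature_charging :
    (∃ U₀ : ℝ, 0 < U₀ ∧ ∀ U ∈ Set.Ioo (0:ℝ) U₀, ∀ δ ∈ Set.Ioo (0:ℝ) (1 / 2), ∀ μ : ℝ, Filter.Tendsto (fun L : ℕ => ((hubbardTorusWith 2 (L + 1) 1 U μ).groundStateFunctional totalNumber).re / ((L + 1 : ℕ) : ℝ) ^ 2) Filter.atTop (nhds (1 - δ)) → HasDWaveOrder U μ → ∃ C η : ℝ, 0 < η ∧ ∀ᶠ k : ℕ in Filter.atTop, ∀ ψ : Fock (Orb (FermionTorus 2 (2 * k + 1 + 1))), IsGroundStateInSector (hubbardTorus 2 (2 * k + 1 + 1) 1 U) (2 * ⌊(1 - δ) * ((2 * k + 1 + 1 : ℕ) : ℝ) ^ 2 / 2⌋₊) 0 ψ → star ψ ⬝ᵥ ψ = 1 → ∀ m : TorusSite 2 (2 * k + 1 + 1), m ≠ 0 → momentumNormSq (2 * k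 + 1 + 1) m < η ^ 2 → (∀ w : Fock (Orb (FermionTorus 2 (2 * k + 1 + 1))), w ∈ szSector (Λ := FermionTorus 2 (2 * k + 1 + 1)) (2 * ⌊(1 - δ) * ((2 * k + 1 + 1 : ℕ) : ℝ) ^ 2 / 2⌋₊ - 2) 0 → 2 * (star w ⬝ᵥ (pairFieldAt dWaveFormFactor (2 * k + 1 + 1) m *ᵥ ψ)).re - ((star w ⬝ᵥ (hubbardTorus 2 (2 * k + 1 + 1) 1 U *ᵥ w)).re - (hubbardTorus 2 (2 * k + 1 + 1) 1 U).minEnergyOn (szSector (2 * ⌊(1 - δ) * ((2 * k + 1 + 1 : ℕ) : ℝ) ^ 2 / 2⌋₊ - 2) 0) * (star w ⬝ᵥ w).re) ≤ C * ((2 * k + 1 + 1 : ℕ) : ℝ) ^ 2 / momentumNormSq (2 * k + 1 + 1) m) ∧ (∀ w : Fock (Orb (FermionTorus 2 (2 * k + 1 + 1))), w ∈ szSector (Λ := FermionTorus 2 (2 * k + 1 + 1)) (2 * ⌊(1 - δ) * ((2 * k + 1 + 1 : ℕ) : ℝ) ^ 2 / 2⌋₊ + 2) 0 → 2 * (star w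 ⬝ᵥ ((pairFieldAt dWaveFormFactor (2 * k + 1 + 1) m)ᴴ *ᵥ ψ)).re - ((star w ⬝ᵥ (hubbardTorus 2 (2 * k + 1 + 1) 1 U *ᵥ w)).re - (hubbardTorus 2 (2 * k + 1 + 1) 1 U).minEnergyOn (szSector (2 * ⌊(1 - δ) * ((2 * k + 1 + 1 : ℕ) : ℝ) ^ 2 / 2⌋₊ + 2) 0) * (star w ⬝ᵥ w).re) ≤ C * ((2 * k + 1 + 1 : ℕ) : ℝ) ^ 2 / momentumNormSq (2 * k + 1 + 1) m)) → (∃ U₀ : ℝ, 0 < U₀ ∧ ∀ U ∈ Set.Ioo (0:ℝ) U₀, ∀ δ ∈ Set.Ioo (0:ℝ) (1 / 2), ∀ μ : ℝ, Filter.Tendsto (fun L : ℕ => ((hubbardTorusWith 2 (L + 1) 1 U μ).groundStateFunctional totalNumber).re / ((L + 1 : ℕ) : ℝ) ^ 2) Filter.atTop (nhds (1 - δ)) → HasDWaveOrder U μ → ∀ R : ℕ, 0 < R → ∃ C : ℝ, 0 ≤ C ∧ ∃ κ₀ : ℝ, 0 < κ₀ ∧ ∃ h₀ : ℝ, 0 <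 h₀ ∧ ∀ κ ∈ Set.Ioo (0:ℝ) κ₀, ∀ h ∈ Set.Ioo (0:ℝ) h₀, ∀ᶠ L : ℕ in Filter.atTop, -C * κ ^ 2 * ((L + 1 : ℕ) : ℝ) ^ 2 ≤ (dWaveSourceTorus (L + 1) U μ h + (κ : ℂ) • (((((R : ℝ) ^ 4)⁻¹ : ℝ) : ℂ) • ∑ a : Literature.Probability.LatticeModels.TorusSite 2 (L + 1), (∑ u : Fin 2 → Fin R, localPair dWaveFormFactor (L + 1) (a + fun i => ((u i : ℕ) : ZMod (L + 1))))ᴴ * (∑ u : Fin 2 → Fin R, localPair dWaveFormFactor (L + 1) (a + fun i => ((u i : ℕ) : ZMod (L + 1)))))).groundEnergy + (dWaveSourceTorus (L + 1) U μ h + ((-κ : ℝ) : ℂ) • (((((R : ℝ) ^ 4)⁻¹ : ℝ) : ℂ) • ∑ a : Literature.Probability.LatticeModels.TorusSite 2 (L + 1), (∑ u : Fin 2 → Fin R, localPair dWaveFormFactor (L + 1) (a + fun i => ((u i : ℕ) : ZMod (L + 1))))ᴴ * (∑ u : Fin 2 → Fin R, localPair dWaveFormFactor (L + 1) (a + fun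 i => ((u i : ℕ) : ZMod (L + 1)))))).groundEnergy - 2 * (dWaveSourceTorus (L + 1) U μ h).groundEnergy) → (∃ U₀ : ℝ, 0 < U₀ ∧ ∀ U ∈ Set.Ioo (0:ℝ) U₀, ∀ δ ∈ Set.Ioo (0:ℝ) (1 / 2), ∀ μ : ℝ, Filter.Tendsto (fun L : ℕ => ((hubbardTorusWith 2 (L + 1) 1 U μ).groundStateFunctional totalNumber).re / ((L + 1 : ℕ) : ℝ) ^ 2) Filter.atTop (nhds (1 - δ)) → HasDWaveOrder U μ → ∀ ε : ℝ, 0 < ε → ∀ᶠ k : ℕ in Filter.atTop, -ε ≤ (1 + Real.log ((2 * k + 1 + 1 : ℕ) : ℝ)) * pairGap (hubbardTorus 2 (2 * k + 1 + 1) 1 U) (2 * ⌊(1 - δ) * ((2 * k + 1 + 1 : ℕ) : ℝ) ^ 2 / 2⌋₊)) → Summit.HubbardSuperconductivity.HubbardSuperconductivity.Theses.WeakCouplingBCS.WcbcsSsbToTorusLRO := by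
  intro hT hN hC
  obtain ⟨U₁, hU₁, hT⟩ := hT
  obtain ⟨U₂, hU₂, hN⟩ := hN
  obtain ⟨U₃, hU₃, hC⟩ := hC
  refine ⟨min U₁ (min U₂ U₃), lt_min hU₁ (lt_min hU₂ hU₃), fun U hU δ hδ μ hdm hord => ?_⟩
  have hU1 : U ∈ Set.Ioo (0:ℝ) U₁ := ⟨hU.1, lt_of_lt_of_le hU.2 (min_le_left _ _)⟩
  have hU2 : U ∈ Set.Ioo (0:ℝ) U₂ := ⟨hU.1, lt_of_lt_of_le hU.2 ((min_le_right _ _).trans (min_le_left _ _))⟩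
  have hU3 : U ∈ Set.Ioo (0:ℝ) U₃ := ⟨hU.1, lt_of_lt_of_le hU.2 ((min_le_right _ _).trans (min_le_right _ _))⟩
  have hP := derivFacePurity_of_neutralCurvature U δ μ hδ (hN U hU2 δ hδ μ hdm hord)
    (CwSsbToEvenTorusLRO.stub_canonicalSupportingPotential U δ ⟨hδ.1, by linarith [hδ.2]⟩) hdm hord
  have hIR := infraredLeak_of_stiffness_of_charging U δ hU.1 hδ (hT U hU1 δ hδ μ hdm hord) (hC U hU3 δ hδ μ hdm hord)
  exact hasDWavePairFieldLROAt_of_floor (floor_of_deriv_of_leak hP hIR)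


end Summit.HubbardSuperconductivity.HubbardSuperconductivity.Theorems.WcbcsSsbToTorusLRO

end
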